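import Summits.MatrixMultiplication.OmegaCensus.AffineExtensionBox

/-!
# ω-census, family (b3): the TWO-ROTATION box of `A ⋊_φ ℤ/n` and its uniform coset pattern (density `2`)

HONEST FRAMING (pub-omega census; verbatim): lottery ticket; floor = certified bounds/negative ranges.
Census BOOKKEEPING (conjecture C9 of the cell, STRUCTURE.md §2; pub-omega kernel-l4 gen 18, task K-8).  The box
`Y = {1, y, τ_α}`, `W = {1, y, τ_β}` of `AffExt A n φ` (`y = (0,1)`, `τ_v = (v,0)`; gauge `sh (i,j) = yv i + wv j`):
* `AffExt.boxF2 α β` and its ORDERED label table `AffExt.labF2 P₁ P₂ Q₁ Q₂ c c'` (`AffExt.lam_DD_boxF2`: for every additive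
  `λ : A →+ P`, `λ(DD c c') = labF2 …` with the FOUR parameters `P₁ = λ(α − φα)`, `P₂ = λ(φα − φ²α)`, `Q₁ = λ(β − φβ)`,
  `Q₂ = λ(φβ − φ²β)` — nothing else about `A`, `φ`, `α`, `β` enters);
* `AffExt.ValidF2` — validity of column sets `S c ⊆ P` against the table (decidable), and `valid_boxF2_of_validF2`;
* THE UNIFORM TEMPLATE `AffExt.tmplF2 m` in `ZMod m` (`h = ⌊m/2⌋`; column `(0,0) ↦ [h, m)`, columns `(0,2), (1,1), (2,1) ↦ [0, h)`,
  parameters `(0, −h, −h, 0)`): valid for EVERY `m` (`tmplF2_valid`) with `m + 2h ≥ 2m − 1` cells, so `9m ≤ 5·Σ` for `m ≥ 2`,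
  `m ≠ 3` (`tmplF2_big`); and the `m = 3` template `tmplF2three` (six singletons, parameters `(2,1,1,1)`, by `decide`);
* **`AffExt.not_boxUseful_of_twoRotation`**: if `(1 : ZMod n) ≠ 0`, `λ : A →+ ZMod p` (`p` prime) is surjective JOINTLY WITH
  `λ ∘ φ` (`∀ x y, ∃ v, λ v = x ∧ λ (φ v) = y`) and `φ` has no non-zero fixed vector, then `A ⋊_φ ℤ/n` is not box-useful.
Used by `AtomBadCoprime.lean`: every Schmidt-atom configuration `AtomConfig p q a y` with `q ∤ p − 1` satisfies these hypotheses.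
Nothing here is progress on `ω`.
-/

namespace Summit.MatrixMultiplication.OmegaCensus

open Finset ProductBoxBound

namespace AffExt

variable {A : Type*} [AddCommGroup A] {n : ℕ} (φ : AddMonoid.End A)
variable {P : Type*} [AddCommGroup P]

/-- The two-rotation box `Y = {1, y, τ_α}`, `W = {1, y, τ_β}` with the gauge `sh (i,j) = yv i + wv j`. [folklore] -/
def boxF2 (α β : A) : ABox A n :=
  ⟨![0, 0, α], ![0, 1, 0], ![0, 0, β], ![0, 1, 0], fun c => ![(0 : A), 0, α] c.1 + ![(0 : A), 0, β] c.2⟩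

/-- The ordered label table of the two-rotation box in the parameters `P₁, P₂, Q₁, Q₂` (entry `[i][j][i'][j']` is the label of
the ordered column pair `((i,j),(i',j'))`). [folklore] -/
def labF2 (P₁ P₂ Q₁ Q₂ : P) (c c' : Fin 3 × Fin 3) : P :=
  (![![![![0, 0, 0], ![0, 0, Q₁], ![0, 0, 0]],
        ![![0, 0, -Q₁], ![0, 0, 0], ![0, 0, -Q₁]],
        ![![0, Q₁, 0], ![0, Q₁, Q₁], ![0, Q₁, 0]]],
      ![![![0, 0, -Q₁], ![0, 0, 0], ![-P₁, -P₂, -P₁ - Q₁]],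
        ![![0, 0, -Q₁ - Q₂], ![0, 0, -Q₂], ![-P₁, -P₂, -P₁ - Q₁ - Q₂]],
        ![![0, Q₂, -Q₁], ![0, Q₂, 0], ![-P₁, -P₂ + Q₂, -P₁ - Q₁]]],
      ![![![0, P₁, 0], ![P₁, P₁ + P₂, P₁ + Q₁], ![0, P₁, 0]],
        ![![-P₁, 0, -P₁ - Q₁], ![0, P₂, 0], ![-P₁, 0, -P₁ - Q₁]],
        ![![0, P₁ + Q₁, 0], ![P₁, P₁ + P₂ + Q₁, P₁ + Q₁], ![0, P₁ + Q₁, 0]]]] :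
    Fin 3 → Fin 3 → Fin 3 → Fin 3 → P) c.1 c.2 c'.1 c'.2

/-- **The forbidden differences of the two-rotation box through any additive `λ`** are the table `labF2` at
`P₁ = λ(α − φα)`, `P₂ = λ(φα − φ²α)`, `Q₁ = λ(β − φβ)`, `Q₂ = λ(φβ − φ²β)` (`φ` entering as `act φ (1 : ZMod n)`). [folklore] -/
theorem lam_DD_boxF2 [NeZero n] [Fact (φ ^ n = 1)] (lam : A →+ P) (α β : A) (c c' : Fin 3 × Fin 3) :
    lam ((boxF2 (n := n) α β).DD φ c c') =
      labF2 (lam α - lam (act φ (1 : ZMod n) α)) (lam (act φ (1 : ZMod n) α) - lam (act φ (1 : ZMod n) (act φ (1 : ZMod n) α)))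
        (lam β - lam (act φ (1 : ZMod n) β)) (lam (act φ (1 : ZMod n) β) - lam (act φ (1 : ZMod n) (act φ (1 : ZMod n) β))) c c' := by
  have hφ : φ ^ n = 1 := Fact.out
  obtain ⟨i, j⟩ := c
  obtain ⟨i', j'⟩ := c'
  fin_cases i <;> fin_cases j <;> fin_cases i' <;> fin_cases j' <;>
    simp [ABox.DD, ABox.sig, boxF2, labF2, act_zero_apply, ← act_act hφ, map_add, map_sub] <;> abel

/-- *Validity* of column sets `S c ⊆ P` for the two-rotation table with parameters `P₁, P₂, Q₁, Q₂`. [folklore] -/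
def ValidF2 (P₁ P₂ Q₁ Q₂ : P) (S : Fin 3 × Fin 3 → Finset P) : Prop :=
  ∀ c c' : Fin 3 × Fin 3, c ≠ c' → ∀ z ∈ S c, ∀ z' ∈ S c', z ≠ z' + labF2 P₁ P₂ Q₁ Q₂ c c'

/-- Validity is decidable. [folklore] -/
instance [DecidableEq P] (P₁ P₂ Q₁ Q₂ : P) (S : Fin 3 × Fin 3 → Finset P) : Decidable (ValidF2 P₁ P₂ Q₁ Q₂ S) := by
  unfold ValidF2; infer_instance

/-- Table validity gives box validity. [folklore] -/
theorem valid_boxF2_of_validF2 [NeZero n] [Fact (φ ^ n = 1)] [DecidableEq P] (lam : A →+ P) (α β : A)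
    (S : Fin 3 × Fin 3 → Finset P)
    (h : ValidF2 (lam α - lam (act φ (1 : ZMod n) α)) (lam (act φ (1 : ZMod n) α) - lam (act φ (1 : ZMod n) (act φ (1 : ZMod n) α)))
      (lam β - lam (act φ (1 : ZMod n) β)) (lam (act φ (1 : ZMod n) β) - lam (act φ (1 : ZMod n) (act φ (1 : ZMod n) β))) S) :
    (boxF2 (n := n) α β).Valid φ lam S := by
  intro c c' hcc' z hz z' hz'
  rw [lam_DD_boxF2]
  exact h c c' hcc' z hz z' hz'

/-- The two-rotation box is nondegenerate when `α ≠ 0`, `β ≠ 0` and `(1 : ZMod n) ≠ 0`. [folklore] -/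
theorem boxF2_nondeg {α β : A} (hα : α ≠ 0) (hβ : β ≠ 0) (h1 : (1 : ZMod n) ≠ 0) : (boxF2 (n := n) α β).Nondeg φ := by
  refine ABox.nondeg_of φ _ ?_ ?_ <;> intro i i' e <;> fin_cases i <;> fin_cases i' <;>
    simp_all [boxF2]

/-! ### The uniform template in `ZMod m` -/

section Template

variable (m : ℕ) [NeZero m]

/-- `[0, h)` in `ZMod m` (by the canonical representative). [folklore] -/
def lowArc (h : ℕ) : Finset (ZMod m) := univ.filter fun z => z.val < h

/-- `[h, m)` in `ZMod m`. [folklore] -/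
def highArc (h : ℕ) : Finset (ZMod m) := univ.filter fun z => h ≤ z.val

/-- The uniform two-rotation template: `(0,0) ↦ [h, m)`, `(0,2), (1,1), (2,1) ↦ [0, h)`, `h = ⌊m/2⌋`, all other columns empty.
[folklore] -/
def tmplF2 (c : Fin 3 × Fin 3) : Finset (ZMod m) :=
  if c = (0, 0) then highArc m (m / 2)
  else if c = (0, 2) ∨ c = (1, 1) ∨ c = (2, 1) then lowArc m (m / 2) else ∅

/-- Membership in `lowArc`. [folklore] -/
@[simp] theorem mem_lowArc {h : ℕ} {z : ZMod m} : z ∈ lowArc m h ↔ z.val < h := by simp [lowArc]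

/-- Membership in `highArc`. [folklore] -/
@[simp] theorem mem_highArc {h : ℕ} {z : ZMod m} : z ∈ highArc m h ↔ h ≤ z.val := by simp [highArc]

/-- `(z + h).val = z.val + h` when `z.val < ⌊m/2⌋ = h`. [folklore] -/
theorem val_add_half {z : ZMod m} (hz : z.val < m / 2) : (z + (m / 2 : ℕ)).val = z.val + m / 2 := by
  rw [ZMod.val_add, ZMod.val_natCast, Nat.mod_eq_of_lt (Nat.div_lt_of_lt_mul (by omega)), Nat.mod_eq_of_lt (by omega)]

/-- In `[0,h)` no two elements differ by `±h` and none lies in `[h,m)` (`h = ⌊m/2⌋`): the three relations used below. [folklore] -/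
theorem lowArc_shift {z z' : ZMod m} (hz : z.val < m / 2) (hz' : z'.val < m / 2) : z ≠ z' + (m / 2 : ℕ) := by
  intro e
  have := congrArg ZMod.val e
  rw [val_add_half m hz'] at this
  omega

/-- **The uniform template is valid** for the parameters `(0, −h, −h, 0)`, `h = ⌊m/2⌋`, in every `ZMod m`. [folklore] -/
theorem tmplF2_valid : ValidF2 (0 : ZMod m) (-((m / 2 : ℕ) : ZMod m)) (-((m / 2 : ℕ) : ZMod m)) 0 (tmplF2 m) := by
  intro c c' hcc' z hz z' hz'
  obtain ⟨i, j⟩ := c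
  obtain ⟨i', j'⟩ := c'
  fin_cases i <;> fin_cases j <;> fin_cases i' <;> fin_cases j' <;>
    simp [tmplF2, labF2] at hcc' hz hz' ⊢
  all_goals first
    | (intro e; subst e; omega)
    | exact lowArc_shift m hz hz'
    | (intro e; rw [← sub_eq_add_neg, eq_sub_iff_add_eq] at e; exact lowArc_shift m hz' hz e.symm)

/-- The column sums of the uniform template: `Σ_c #(tmplF2 m c) = m + 2⌊m/2⌋`. [folklore] -/
theorem tmplF2_sum : ∑ c, #(tmplF2 m c) = m + 2 * (m / 2) := by
  have hlow : #(lowArc m (m / 2)) = m / 2 := by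
    have : lowArc m (m / 2) = (range (m / 2)).image (fun k : ℕ => (k : ZMod m)) := by
      ext z
      simp only [mem_lowArc, mem_image, mem_range]
      constructor
      · intro hz; exact ⟨z.val, hz, ZMod.natCast_zmod_val z⟩
      · rintro ⟨k, hk, rfl⟩
        rw [ZMod.val_natCast, Nat.mod_eq_of_lt (by omega)]; exact hk
    rw [this, card_image_of_injOn, card_range]
    intro k hk k' hk' e
    have := congrArg ZMod.val e
    simp only [mem_coe, mem_range] at hk hk'
    rwa [ZMod.val_natCast, ZMod.val_natCast, Nat.mod_eq_of_lt (by omega), Nat.mod_eq_of_lt (by omega)] at this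
  have hhigh : #(highArc m (m / 2)) = m - m / 2 := by
    have hc : highArc m (m / 2) = univ \ lowArc m (m / 2) := by
      ext z; simp [not_lt]
    rw [hc, card_sdiff_of_subset (subset_univ _), card_univ, ZMod.card, hlow]
  rw [Fintype.sum_prod_type]
  simp [Fin.sum_univ_three, tmplF2, hlow, hhigh]
  omega

/-- `9m ≤ 5·Σ_c #(tmplF2 m c)` for `m ≥ 2`, `m ≠ 3`. [folklore] -/
theorem tmplF2_big (h2 : 2 ≤ m) (h3 : m ≠ 3) : 9 * m ≤ 5 * ∑ c, #(tmplF2 m c) := by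
  rw [tmplF2_sum]; omega

end Template

/-- The template for `ZMod 3`: six singletons, parameters `(2, 1, 1, 1)`. [folklore] -/
def tmplF2three (c : Fin 3 × Fin 3) : Finset (ZMod 3) :=
  (![![∅, ∅, {0}], ![{1}, {0}, {0}], ![{1}, ∅, {2}]] : Fin 3 → Fin 3 → Finset (ZMod 3)) c.1 c.2

/-- The `ZMod 3` template is valid. [folklore] -/
theorem tmplF2three_valid : ValidF2 (2 : ZMod 3) 1 1 1 tmplF2three := by
  unfold ValidF2; decide

/-- The `ZMod 3` template has `6` cells: `9·3 ≤ 5·6`. [folklore] -/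
theorem tmplF2three_big : 9 * 3 ≤ 5 * ∑ c, #(tmplF2three c) := by decide

/-! ### The theorem -/

/-- Solving `v − φ v = w` when `φ` has no non-zero fixed vector (finite `A`). [folklore] -/
theorem exists_sub_act_eq [Finite A] (hfix : ∀ v : A, φ v = v → v = 0) (w : A) : ∃ v : A, v - φ v = w := by
  have hinj : Function.Injective fun v : A => v - φ v := by
    intro v v' e
    have h0 : v - v' = φ v - φ v' := sub_eq_sub_iff_sub_eq_sub.1 e
    rw [← map_sub] at h0
    exact sub_eq_zero.1 (hfix _ h0.symm)
  exact Finite.surjective_of_injective hinj w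

/-- **The two-rotation theorem.** Let `p` be a prime, `λ : A →+ ZMod p` surjective jointly with `λ ∘ φ`, `φ` without non-zero
fixed vectors, `(1 : ZMod n) ≠ 0`.  Then `A ⋊_φ ℤ/n` is not box-useful: the coset pattern of the uniform template (or of the
`ZMod 3` template) on the box `{1, y, τ_α} × {1, y, τ_β}` for suitable `α, β` has `≥ (9/5)·|A|·n` independent cells. [folklore] -/
theorem not_boxUseful_of_twoRotation [Fintype A] [DecidableEq A] [NeZero n] [Fact (φ ^ n = 1)] {p : ℕ} [Fact p.Prime]
    (lam : A →+ ZMod p) (hpair : ∀ x y : ZMod p, ∃ v : A, lam v = x ∧ lam (act φ (1 : ZMod n) v) = y)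
    (hfix : ∀ v : A, act φ (1 : ZMod n) v = v → v = 0) (h1 : (1 : ZMod n) ≠ 0) : ¬ BoxUseful (AffExt A n φ) := by
  have hp : p.Prime := Fact.out
  have hlam : Function.Surjective lam := fun x => by obtain ⟨v, hv, -⟩ := hpair x 0; exact ⟨v, hv⟩
  -- realise prescribed parameters: `α` with `(λ(α − φα), λ(φα − φ²α)) = (x, y)`
  have realise : ∀ x y : ZMod p, ¬ (x = 0 ∧ y = 0) → ∃ α : A, α ≠ 0 ∧ lam α - lam (act φ (1 : ZMod n) α) = x ∧
      lam (act φ (1 : ZMod n) α) - lam (act φ (1 : ZMod n) (act φ (1 : ZMod n) α)) = y := by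
    intro x y hxy
    obtain ⟨w, hw1, hw2⟩ := hpair x y
    obtain ⟨α, hα⟩ := exists_sub_act_eq (act φ (1 : ZMod n)) hfix w
    refine ⟨α, ?_, ?_, ?_⟩
    · rintro rfl
      rw [map_zero, sub_zero] at hα
      subst hα
      rw [map_zero] at hw1; rw [map_zero, map_zero] at hw2
      exact hxy ⟨hw1.symm, hw2.symm⟩
    · rw [← map_sub, hα, hw1]
    · rw [← map_sub, ← map_sub, hα, hw2]
  by_cases hp3 : p = 3
  · subst hp3
    obtain ⟨α, hα, ha1, ha2⟩ := realise 2 1 (by simp)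
    obtain ⟨β, hβ, hb1, hb2⟩ := realise 1 1 (by simp)
    refine (boxF2 α β).not_boxUseful_of_cosetPattern φ lam tmplF2three (boxF2_nondeg φ hα hβ h1) hlam ?_
      (by rw [ZMod.card]; exact tmplF2three_big)
    apply valid_boxF2_of_validF2
    rw [ha1, ha2, hb1, hb2]
    exact tmplF2three_valid
  · haveI : NeZero p := ⟨hp.ne_zero⟩
    have hh0 : ((p / 2 : ℕ) : ZMod p) ≠ 0 := by
      rw [Ne, ZMod.natCast_eq_zero_iff]
      intro hdvd
      have h2 := hp.two_le
      have := Nat.le_of_dvd (Nat.div_pos h2 (by norm_num)) hdvd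
      omega
    obtain ⟨α, hα, ha1, ha2⟩ := realise 0 (-((p / 2 : ℕ) : ZMod p)) (by simp [hh0])
    obtain ⟨β, hβ, hb1, hb2⟩ := realise (-((p / 2 : ℕ) : ZMod p)) 0 (by simp [hh0])
    refine (boxF2 α β).not_boxUseful_of_cosetPattern φ lam (tmplF2 p) (boxF2_nondeg φ hα hβ h1) hlam ?_
      (by rw [ZMod.card]; exact tmplF2_big p hp.two_le hp3)
    apply valid_boxF2_of_validF2
    rw [ha1, ha2, hb1, hb2]
    exact tmplF2_valid p

end AffExt

end Summit.MatrixMultiplication.OmegaCensus
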